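import Literature.NumberTheory.Automorphic.GLnCuspidalSiegelKernel
import Literature.NumberTheory.Automorphic.TestFunctionGLLeftInvariance
import Literature.NumberTheory.Automorphic.AutomorphicRepsGL
import HarnessLib

/-!
# Cusp forms along a block unipotent radical: the level absorbs small finite steps, and the cusp
# condition bounds the form by its oscillation over a scaled Tate domain
(Moeglin–Waldspurger, *Spectral decomposition and Eisenstein series* (1995), proof of Lemma I.2.10:
the compact open subgroup `Γ_i = V_i(𝔸_f) ∩ ⋂_{g ∈ S} g K'_f g⁻¹` and the identity
`φ_i(ag) = ∫ φ_{i-1}(u a g) du`; Getz–Hahn (2024), Lemma 9.4.2)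

Topic `NumberTheory/Automorphic`; a brick of the discharge of the named fact
`AutomorphicRepsGL.rapidlyDecreasingOnSiegelSets_of_cuspidal` (MW Cor. I.2.12 for `GL_n`). Two
elementary steps of MW's proof of Lemma I.2.10, for a function `φ` on `GL_n(𝔸_K)` that is right
invariant under an admissible level `U ∈ finiteLevelsGL n K` (`{1} × U₀`, `U₀` compact open):

* `exists_forall_conj_mem_of_mem_finiteLevelsGL` — **uniform level under conjugation by a compact
  set**: for every compact `Θ ⊆ GL_n(𝔸_K)` there is an ideal `𝔫 ≠ 0` with `θ⁻¹ κ θ ∈ U` for all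
  `θ ∈ Θ` and `κ` in the principal congruence subgroup `K(𝔫)` (tube lemma, as in
  `TestFunctionGLLeftInvariance`; MW's `Γ_i`, Getz–Hahn's `N(𝔸_F) ∩ h K' h⁻¹`);
* `unipotentOfBlock_mem_principalCongruenceLevel_of_mem_finIntegralBlock` — a block unipotent `1 + P`
  with `P_∞ = 0` and `c`-divisible integral finite entries (`finIntegralBlock c`, `c ∈ 𝔫`) lies in
  `K(𝔫)`; hence (`apply_unipotentOfBlock_mul_eq_of_conj_mem`,
  `exists_int_forall_apply_unipotentOfBlock_mul_eq`) **`φ (x (1 + P) m θ) = φ (x m θ)` for all such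
  `P`, all archimedean `m`, all `θ ∈ Θ` and all `x`** — finite unipotent steps drop out;
* `norm_le_of_cuspConditionGL` — **the cusp condition bounds `φ` by its oscillation**: if the
  constant term of `φ` along `P_k` vanishes (`CuspConditionGL n K φ k`), then for every `c ≠ 0`
  and every `g`, `‖φ g‖ ≤ M` as soon as `‖φ ((1 + X) g) - φ g‖ ≤ M` for all `X` in the scaled Tate
  domain `c · 𝓕₀` (`scaledBlockFundamentalDomain`, a fundamental domain for `𝔫_k(K)` of finite
  positive Haar measure, on which `φ ((1 + X) g)` has mean zero).

Everything here is proved.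

## References

* C. Moeglin, J.-L. Waldspurger, *Spectral decomposition and Eisenstein series*, Cambridge Tracts
  in Math. 113 (1995), proof of Lemma I.2.10 [MoeglinWaldspurger1995].
* J. R. Getz, H. Hahn, *An Introduction to Automorphic Representations*, GTM 300 (2024),
  Lemma 9.4.2 (printed p. 183) [GetzHahn2024].
-/

noncomputable section

open scoped MatrixGroups Classical
open NumberField NumberField.mixedEmbedding IsDedekindDomain Set Filter MeasureTheory
open _root_.Topology

namespace Literature.NumberTheory.Automorphic

variable {n : ℕ} {K : Type} [Field K] [NumberField K]

/-! ### Uniform level under conjugation by a compact set -/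

/-- **Uniform level under conjugation by a compact set** (MW (1995), proof of Lemma I.2.10, the
compact open subgroup `Γ_i = V_i(𝔸_f) ∩ ⋂_{g ∈ S} g K'_f g⁻¹`; Getz–Hahn (2024), Lemma 9.4.2): for an
admissible level `U = {1} × U₀` (`U₀ ≤ GL_n(𝔸_K^∞)` compact open) and a compact
`Θ ⊆ GL_n(𝔸_K)` there is `𝔫 ≠ 0` such that `θ⁻¹ κ θ ∈ U` for all `θ ∈ Θ` and all `κ` in the
principal congruence subgroup `K(𝔫)`: `θ⁻¹ κ θ = (1, θ_f⁻¹ κ_f θ_f)` and `θ_f⁻¹ κ_f θ_f ∈ U₀` for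
`κ_f` in a neighbourhood of `1` uniform in `θ` (tube lemma), which contains a `K(𝔫)`
(`exists_principalCongruenceLevel_subset`). [cite: MoeglinWaldspurger1995, proof of Lemma I.2.10] -/
theorem exists_forall_conj_mem_of_mem_finiteLevelsGL {U : Subgroup (GL (Fin n) (AdeleRing (𝓞 K) K))}
    (hU : U ∈ finiteLevelsGL n K) {Θ : Set (GL (Fin n) (AdeleRing (𝓞 K) K))} (hΘ : IsCompact Θ) :
    ∃ 𝔫 : Ideal (𝓞 K), 𝔫 ≠ 0 ∧
      ∀ θ ∈ Θ, ∀ κ ∈ principalCongruenceLevel n K 𝔫, θ⁻¹ * κ * θ ∈ U := by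
  obtain ⟨U₀, hU₀o, -, rfl⟩ := hU
  have hsnd : Continuous (GLn.sndHom n K) := GLn.continuous_sndHom
  have hW : IsOpen (GLn.sndConjInv n K ⁻¹' (U₀ : Set (GL (Fin n) (FiniteAdeleRing (𝓞 K) K)))) :=
    hU₀o.preimage GLn.continuous_sndConjInv
  have hΘW : Θ ×ˢ ({1} : Set (GL (Fin n) (FiniteAdeleRing (𝓞 K) K))) ⊆
      GLn.sndConjInv n K ⁻¹' U₀ := by
    intro p hp
    rw [mem_prod, mem_singleton_iff] at hp
    have hp' : p = (p.1, 1) := Prod.ext rfl hp.2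
    rw [mem_preimage, hp', GLn.sndConjInv_one]
    exact one_mem U₀
  obtain ⟨u, v, -, hv, hΘu, h1v, huv⟩ := generalized_tube_lemma hΘ isCompact_singleton hW hΘW
  have h1v' : (1 : GL (Fin n) (FiniteAdeleRing (𝓞 K) K)) ∈ v := h1v rfl
  have hnhds : (GLn.sndHom n K) ⁻¹' v ∈ 𝓝 (1 : GL (Fin n) (AdeleRing (𝓞 K) K)) :=
    (hv.preimage hsnd).mem_nhds (by rw [mem_preimage, map_one]; exact h1v')
  obtain ⟨𝔫, h𝔫, hsub⟩ := exists_principalCongruenceLevel_subset n K hnhds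
  refine ⟨𝔫, h𝔫, fun θ hθ κ hκ => ?_⟩
  have hκ1 : GLn.fstHom n K κ = 1 := fstHom_eq_one_of_mem_principalCongruenceLevel hκ
  rw [GLn.inv_mul_mul_eq_ofFinite hκ1 θ]
  refine Subgroup.mem_map_of_mem _ ?_
  have h := huv (mk_mem_prod (hΘu hθ) (hsub hκ))
  exact h

/-! ### Finite unipotent steps drop out -/

/-- **A block unipotent with trivial archimedean part and `c`-divisible integral finite entries lies
in `K(𝔫)`** (`c ∈ 𝔫 ≠ 0`; `unipotentOfBlock_mem_principalCongruenceLevel` on the subgroup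
`finIntegralBlock c` of `GLnCuspidalSiegelKernel`). [folklore] -/
theorem unipotentOfBlock_mem_principalCongruenceLevel_of_mem_finIntegralBlock {𝔫 : Ideal (𝓞 K)}
    (h𝔫 : 𝔫 ≠ 0) {c : 𝓞 K} (hc : c ∈ 𝔫) {k : ℕ} {P : blockNilpotent n k (AdeleRing (𝓞 K) K)}
    (hP : P ∈ finIntegralBlock c) :
    unipotentOfBlock n k (AdeleRing (𝓞 K) K) (Multiplicative.ofAdd P) ∈
      principalCongruenceLevel n K 𝔫 :=
  unipotentOfBlock_mem_principalCongruenceLevel h𝔫 hc hP.1 hP.2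

/-- A block unipotent with trivial archimedean part commutes with every archimedean element
`(m, 1)`. [folklore] -/
theorem commute_ofInfinite_unipotentOfBlock_of_mem_finIntegralBlock {c : 𝓞 K} {k : ℕ}
    {P : blockNilpotent n k (AdeleRing (𝓞 K) K)} (hP : P ∈ finIntegralBlock c)
    (m : GL (Fin n) (mixedSpace K)) :
    Commute (GLn.ofInfinite n K m) (unipotentOfBlock n k (AdeleRing (𝓞 K) K) (Multiplicative.ofAdd P)) := by
  have h1 : GLn.fstHom n K (unipotentOfBlock n k (AdeleRing (𝓞 K) K) (Multiplicative.ofAdd P)) = 1 := by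
    refine Matrix.GeneralLinearGroup.ext fun i j => ?_
    change (((1 : Matrix (Fin n) (Fin n) (AdeleRing (𝓞 K) K)) +
      (P : Matrix (Fin n) (Fin n) (AdeleRing (𝓞 K) K))) i j).1 = _
    rw [Matrix.add_apply]
    change ((1 : Matrix (Fin n) (Fin n) (AdeleRing (𝓞 K) K)) i j).1 +
      ((P : Matrix (Fin n) (Fin n) (AdeleRing (𝓞 K) K)) i j).1 = _
    rw [hP.1 i j, add_zero, fst_one_apply]
    rfl
  rw [GLn.eq_ofFinite_sndHom_of_fstHom_eq_one h1]
  exact GLn.commute_ofInfinite_ofFinite (n := n) (K := K) m _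

/-- **Finite steps drop out**: if `φ` is right invariant under `U` and `g⁻¹ (1 + P) g ∈ U`, then
`φ (x (1 + P) g) = φ (x g)` for all `x` (`x (1+P) g = x g · g⁻¹ (1+P) g`). [folklore] -/
theorem apply_unipotentOfBlock_mul_eq_of_conj_mem {U : Subgroup (GL (Fin n) (AdeleRing (𝓞 K) K))}
    {φ : GL (Fin n) (AdeleRing (𝓞 K) K) → ℂ} (hφU : IsRightInvariantUnder U φ) {k : ℕ}
    {P : blockNilpotent n k (AdeleRing (𝓞 K) K)} {g : GL (Fin n) (AdeleRing (𝓞 K) K)}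
    (hmem : g⁻¹ * unipotentOfBlock n k (AdeleRing (𝓞 K) K) (Multiplicative.ofAdd P) * g ∈ U)
    (x : GL (Fin n) (AdeleRing (𝓞 K) K)) :
    φ (x * unipotentOfBlock n k (AdeleRing (𝓞 K) K) (Multiplicative.ofAdd P) * g) = φ (x * g) := by
  have h := hφU _ hmem (x * g)
  rwa [show x * g * (g⁻¹ * unipotentOfBlock n k (AdeleRing (𝓞 K) K) (Multiplicative.ofAdd P) * g) =
    x * unipotentOfBlock n k (AdeleRing (𝓞 K) K) (Multiplicative.ofAdd P) * g by
      simp only [mul_assoc, mul_inv_cancel_left]] at h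

/-- **Finite unipotent steps drop out of a level-invariant function, uniformly at the points
`m θ`, `θ` in a compact set** (MW (1995), proof of Lemma I.2.10: "the function `u ↦ φ_{i-1}(uag)` is
right invariant under `Γ_i`"; Getz–Hahn (2024), Lemma 9.4.2). For `φ` right invariant under an
admissible level `U` and a compact `Θ ⊆ GL_n(𝔸_K)` there is a non-zero `c ∈ 𝓞 K` such that
`φ (x (1 + P) (m, 1) θ) = φ (x (m, 1) θ)` for every `x`, every archimedean `m ∈ GL_n(K_∞)`, every
`θ ∈ Θ` and every `P ∈ 𝔫_k(𝔸_K)` with `P_∞ = 0` and `c`-divisible integral finite entries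
(`finIntegralBlock c`): `((m,1) θ)⁻¹ (1+P) (m,1) θ = θ⁻¹ (1+P) θ ∈ θ⁻¹ K(𝔫) θ ⊆ U`.
[cite: MoeglinWaldspurger1995, proof of Lemma I.2.10] -/
theorem exists_int_forall_apply_unipotentOfBlock_mul_eq {U : Subgroup (GL (Fin n) (AdeleRing (𝓞 K) K))}
    (hU : U ∈ finiteLevelsGL n K) {φ : GL (Fin n) (AdeleRing (𝓞 K) K) → ℂ}
    (hφU : IsRightInvariantUnder U φ) {Θ : Set (GL (Fin n) (AdeleRing (𝓞 K) K))}
    (hΘ : IsCompact Θ) :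
    ∃ c : 𝓞 K, c ≠ 0 ∧ ∀ (k : ℕ) (P : blockNilpotent n k (AdeleRing (𝓞 K) K)),
      P ∈ finIntegralBlock c → ∀ θ ∈ Θ, ∀ (m : GL (Fin n) (mixedSpace K))
        (x : GL (Fin n) (AdeleRing (𝓞 K) K)),
        φ (x * unipotentOfBlock n k (AdeleRing (𝓞 K) K) (Multiplicative.ofAdd P) *
            (GLn.ofInfinite n K m * θ)) =
          φ (x * (GLn.ofInfinite n K m * θ)) := by
  obtain ⟨𝔫, h𝔫, hconj⟩ := exists_forall_conj_mem_of_mem_finiteLevelsGL hU hΘ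
  have hbot : (𝔫 : Submodule (𝓞 K) (𝓞 K)) ≠ ⊥ := by rwa [Ne, ← Submodule.zero_eq_bot]
  obtain ⟨c, hc𝔫, hc0⟩ := 𝔫.ne_bot_iff.1 hbot
  refine ⟨c, hc0, fun k P hP θ hθ m x => apply_unipotentOfBlock_mul_eq_of_conj_mem hφU ?_ x⟩
  have hκ := unipotentOfBlock_mem_principalCongruenceLevel_of_mem_finIntegralBlock (n := n) h𝔫 hc𝔫 hP
  have hcomm := (commute_ofInfinite_unipotentOfBlock_of_mem_finIntegralBlock hP m).eq
  set u := unipotentOfBlock n k (AdeleRing (𝓞 K) K) (Multiplicative.ofAdd P) with hu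
  have key : (GLn.ofInfinite n K m * θ)⁻¹ * u * (GLn.ofInfinite n K m * θ) = θ⁻¹ * u * θ := by
    rw [mul_inv_rev]
    calc θ⁻¹ * (GLn.ofInfinite n K m)⁻¹ * u * (GLn.ofInfinite n K m * θ)
        = θ⁻¹ * ((GLn.ofInfinite n K m)⁻¹ * (u * GLn.ofInfinite n K m)) * θ := by
          simp only [mul_assoc]
      _ = θ⁻¹ * u * θ := by rw [← hcomm, inv_mul_cancel_left]
  rw [key]
  exact hconj θ hθ _ hκ

/-! ### The cusp condition bounds the form by its oscillation -/

/-- **The cusp condition bounds `φ` by its oscillation over a scaled Tate domain** (MW (1995),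
proof of Lemma I.2.10, `φ_i(ag) = ∫_{ℤ^d\ℝ^d} φ_{i-1}(exp(∑ x_ℓ X_{iℓ}) a g) ∏ dx_ℓ` with `φ_P = 0`
for cuspidal `φ`): if the constant term of `φ` along `P_k` vanishes (`CuspConditionGL n K φ k`),
then for the scaled Tate domain `𝓕 = c · 𝓕₀` (`c ≠ 0`; a fundamental domain of `𝔫_k(K)` in
`𝔫_k(𝔸_K)` of finite positive Haar measure, `BlockUnipotentDomains`) and every `g`:
`ν(𝓕) φ(g) = ∫_𝓕 (φ(g) - φ((1+X) g)) dν(X)`, so `‖φ g‖ ≤ M` whenever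
`‖φ((1 + X) g) - φ g‖ ≤ M` for all `X ∈ 𝓕`. [cite: MoeglinWaldspurger1995, proof of Lemma I.2.10] -/
theorem norm_le_of_cuspConditionGL {φ : (AdelicGroupData.gl n K).Adelic → ℂ} {k : ℕ}
    (hcusp : CuspConditionGL n K φ k) {c : K} (hc : c ≠ 0) (g : (AdelicGroupData.gl n K).Adelic)
    {M : ℝ} (hM : ∀ X ∈ scaledBlockFundamentalDomain n k K c,
      ‖φ (glUnipotent n k K (Multiplicative.ofAdd X) * g) - φ g‖ ≤ M) :
    ‖φ g‖ ≤ M := by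
  set ν : Measure (blockNilpotent n k (AdeleRing (𝓞 K) K)) := blockHaar n k K with hν
  set 𝓕 := scaledBlockFundamentalDomain n k K c with h𝓕
  obtain ⟨hint, hzero⟩ := hcusp ν 𝓕 (isAddFundamentalDomain_scaledBlockFundamentalDomain hc ν) g
  have hlt : ν 𝓕 < ⊤ := measure_scaledBlockFundamentalDomain_lt_top c ν
  have hne : ν 𝓕 ≠ 0 := measure_scaledBlockFundamentalDomain_ne_zero hc ν
  have hpos : 0 < ν.real 𝓕 := ENNReal.toReal_pos hne hlt.ne
  -- `M ≥ 0` (the domain is non-empty)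
  have h𝓕ne : 𝓕.Nonempty := nonempty_of_measure_ne_zero hne
  obtain ⟨X₀, hX₀⟩ := h𝓕ne
  have hM0 : 0 ≤ M := (norm_nonneg _).trans (hM X₀ hX₀)
  -- `ν(𝓕) φ(g) = ∫_𝓕 (φ g - φ((1+X)g))`
  have hconst : ∫ _ in 𝓕, φ g ∂ν = ν.real 𝓕 • φ g := setIntegral_const _
  have hci : IntegrableOn (fun _ : blockNilpotent n k (AdeleRing (𝓞 K) K) => φ g) 𝓕 ν :=
    integrableOn_const (hs := hlt.ne) (hC := enorm_ne_top)
  have hsub : ∫ X in 𝓕, (φ g - φ (glUnipotent n k K (Multiplicative.ofAdd X) * g)) ∂ν =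
      ν.real 𝓕 • φ g := by
    rw [integral_sub hci.integrable hint.integrable, hzero, sub_zero, hconst]
  have hbound : ‖∫ X in 𝓕, (φ g - φ (glUnipotent n k K (Multiplicative.ofAdd X) * g)) ∂ν‖ ≤
      M * ν.real 𝓕 :=
    norm_setIntegral_le_of_norm_le_const hlt fun X hX => by
      rw [norm_sub_rev]; exact hM X hX
  rw [hsub, _root_.norm_smul, Real.norm_of_nonneg hpos.le, mul_comm] at hbound
  exact le_of_mul_le_mul_right hbound hpos

end Literature.NumberTheory.Automorphic
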